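import Summits.Ventures.LatticeQCDFlow.Scaling.WeightedHubSchemeFloor

/-!
HONEST FRAMING: exact (Metropolis-corrected) sampling algorithms for lattice gauge theory; figures
of merit are autocorrelation/cost numbers at stated couplings and volumes; no continuum-physics
claim.

# FlowHubSchemeFloor — MAPS ON THE HUB EDGES CHANGE THE CONSTANT, NOT THE POWER: THE STAR SCHEME WHOSE EDGE `(0,k+1)`
# EXCHANGES THROUGH A BIJECTION `φ_k` IS CONJUGATE TO THE PLAIN STAR FOR THE PULLED-BACK COLD LAWS `μ_{k+1}∘φ_k`, SO
# `Gap ≥ 1/(3K(ρ²+1)/(tρ⁴) + (ρ³+3K)/(ρ³γ₀(1−t)w_0))` WITH THE TRANSPORT RATIO `ρ·μ_0 ≤ μ_{k+1}∘φ_k ≤ μ_0/ρ` IN PLACE OF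
# THE OVERLAP RATIO; PERFECT TRANSPORTS AND HOT-ONLY UPDATES: `Gap ≥ min{t, γ₀(1−t)}/(10K)` FOR ARBITRARY COLD LAWS
# (lean-2 GEN-21, ours)

Venture-side (OURS).  Cell `lqcd-flow` (pub-lqcd), unit `pub-lqcd-lean-2-g21`, 2026-08-26.  Chapter I, second file (sequel
of `Scaling/WeightedHubSchemeFloor`).  The map-assisted star: `P^φ = t·GSw^φ + (1−t)·prodKernel w M` with
`GSw^φ = ptGraphSwap μ e φ` of `Scaling/ReplicaExchangeGraphSwap` on the star edges `e_k = (0, k+1)` — a swap along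
`e_k` hands `φ_k(x_0)` to level `k+1` and `φ_k⁻¹(x_{k+1})` to the hot level, Metropolis-corrected for the product law.
THE MECHANISM is a relabelling of the state space: `Ψ(x)_0 = x_0`, `Ψ(x)_{k+1} = φ_k⁻¹(x_{k+1})` carries `P^φ` for the
laws `μ` and updates `M` EXACTLY onto the identity-map star `P^1` for the pulled-back laws `ν_0 = μ_0`,
`ν_{k+1} = μ_{k+1}∘φ_k` and the conjugated updates `M_k^φ` (§2), and the spectral gap is invariant under relabelling
(§1).  Hence every floor of `WeightedHubSchemeFloor` holds for `P^φ` with the two-sided TRANSPORT ratio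
`ρ·μ_0(u) ≤ μ_{k+1}(φ_k u) ≤ μ_0(u)/ρ` in place of the overlap ratio `r` — a trained map between the hot law and each
cold law replaces the overlap penalty (`r⁴`, `r³`, exponentially small in an energy gap) by the transport penalty,
while the power of `K` stays what the topology and the update weights make it (one, for the hot-weighted hub).

## What is proved

* §1 (generic, finite state spaces) `orthEigenvalues_conj_subset`, **`spectralGap_conj`** (the spectral gap is
  invariant under a bijective relabelling of the states), `mhKernel_conj` (Metropolis–Hastings kernels relabel with
  their proposal and weight), `prodKernel_conj` (single-replica update kernels relabel coordinatewise).
* §2 `starRelabel_edgeFlowSwap` (`Ψ(x ⋄_k φ_k) = Ψ(x)∘τ_k`), `tensorFun_starRelabel`, `ptGraphProposal_starRelabel`,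
  **`flowStar_apply_eq_conj`** (`P^φ(x,y) = P^1_ν(Ψx,Ψy)`), **`flowStar_spectralGap_eq`** (`Gap_π̃(P^φ) = Gap_ν̃(P^1_ν)`).
* §3 **`flowStar_spectralGap_ge`** — `Gap(P^φ) ≥ 1/(3K(ρ²+1)/(tρ⁴) + (ρ³+3K)/(ρ³γ₀(1−t)w_0))` (`w_0 > 0`, cold updates
  arbitrary `μ_k`-reversible); **`flowStarPerfect_spectralGap_ge_linear`** — perfect transports `μ_{k+1}∘φ_k = μ_0`
  and hot-only updates: `Gap(P^φ) ≥ min{t, γ₀(1−t)}/(10K)` whatever the cold laws; `flowStar_sectorCount_eq` and the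
  TWO-SIDED LAW **`flowStarPerfect_spectralGap_two_sided`** for sector-preserving perfect transports:
  `min{t, γ₀(1−t)}/(10K) ≤ Gap(P^φ) ≤ t·min{μ_0(A), μ_0(Aᶜ)}/(K·v)`.

Reading (no numerics implied): on the exchange side a learned map buys exactly the replacement `r ↦ ρ` in the
relaxation guarantee; the linear law in the number of cold clients is then met with a constant set by the hot replica
alone (`γ₀`, `t`).  NOT CLAIMED: maps on a ladder or a general swap graph (one map per cold level is what the
conjugation needs); continuous configuration spaces (there `φ` carries a Jacobian); anything measured.  Literature
grade (cell rule): OWN MECHANISM, NEW TYPING; nothing cited as a fact; no new bib keys.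
-/

noncomputable section

open Finset Function
open Literature.Probability.MarkovChains

namespace Summit.Ventures.LatticeQCDFlow.Scaling

/-! ## §1 Relabelling a finite chain -/

section Generic

variable {X Y : Type*} [Fintype X] [Fintype Y]

/-- Eigenvalues with a mean-zero eigenfunction are kept by a relabelling `e : X ≃ Y` of the states
(`π^e = π∘e`, `P^e(x,x') = P(e x, e x')`): `orthEigenvalues π^e P^e ⊆ orthEigenvalues π P`. [ours] -/
theorem orthEigenvalues_conj_subset (e : X ≃ Y) (π : Y → ℝ) (P : Matrix Y Y ℝ) :
    orthEigenvalues (fun x => π (e x)) (fun x x' => P (e x) (e x')) ⊆ orthEigenvalues π P := by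
  rintro lam ⟨f, hf0, hfm, hfP⟩
  refine ⟨fun y => f (e.symm y), ?_, ?_, ?_⟩
  · intro h
    apply hf0
    funext x
    have hx := congrFun h (e x)
    simp only [Equiv.symm_apply_apply, Pi.zero_apply] at hx
    exact hx
  · rw [← e.sum_comp]
    simp only [Equiv.symm_apply_apply]
    exact hfm
  · funext y
    have h := congrFun hfP (e.symm y)
    simp only [Matrix.mulVec, dotProduct, Pi.smul_apply, smul_eq_mul, Equiv.apply_symm_apply] at h ⊢
    rw [← e.sum_comp]
    simp only [Equiv.symm_apply_apply]
    exact h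

/-- **The spectral gap is invariant under a relabelling of the states:** `Gap_{π∘e}(P^e) = Gap_π(P)`. [ours] -/
theorem spectralGap_conj (e : X ≃ Y) (π : Y → ℝ) (P : Matrix Y Y ℝ) :
    spectralGap (fun x => π (e x)) (fun x x' => P (e x) (e x')) = spectralGap π P := by
  have h1 := orthEigenvalues_conj_subset e π P
  have h2 := orthEigenvalues_conj_subset e.symm (fun x => π (e x)) (fun x x' => P (e x) (e x'))
  simp only [Equiv.apply_symm_apply] at h2
  unfold spectralGap secondEigenvalue
  rw [Set.Subset.antisymm h1 h2]

variable [DecidableEq X] [DecidableEq Y]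

/-- **Metropolis–Hastings kernels relabel:** if `T(x,y) = T'(e x, e y)` and `π(x) = π'(e x)` then
`mhKernel T π x y = mhKernel T' π' (e x) (e y)`. [ours] -/
theorem mhKernel_conj (e : X ≃ Y) {T : X → X → ℝ} {T' : Y → Y → ℝ} {π : X → ℝ} {π' : Y → ℝ}
    (hT : ∀ x y, T x y = T' (e x) (e y)) (hπ : ∀ x, π x = π' (e x)) (x y : X) :
    mhKernel T π x y = mhKernel T' π' (e x) (e y) := by
  have hrate : ∀ a b, mhRate T π a b = mhRate T' π' (e a) (e b) := fun a b => by
    unfold mhRate; rw [hT, hT, hπ, hπ]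
  by_cases h : y = x
  · subst h
    rw [mhKernel_self, mhKernel_self, Finset.sum_erase_eq_sub (mem_univ _), Finset.sum_erase_eq_sub (mem_univ _),
      show ∑ z, mhRate T π y z = ∑ z, mhRate T' π' (e y) (e z) from sum_congr rfl fun z _ => hrate y z,
      e.sum_comp (fun z => mhRate T' π' (e y) z), hrate]
  · rw [mhKernel_of_ne h, mhKernel_of_ne (fun h' => h (e.injective h')), hrate]

end Generic

variable {S : Type*} [Fintype S] [DecidableEq S] {K : ℕ} {μ : Fin (K + 1) → S → ℝ}
  {M : Fin (K + 1) → S → S → ℝ} {w : Fin (K + 1) → ℝ} {t : ℝ}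

omit [Fintype S] in
/-- **Single-replica updates relabel coordinatewise:** for level bijections `L_i`,
`prodKernel w M x y = prodKernel w M^L (L∘x) (L∘y)` with `M^L_i(u,v) = M_i(L_i⁻¹u, L_i⁻¹v)`. [ours] -/
theorem prodKernel_conj [Fintype S] (L : Fin (K + 1) → Equiv.Perm S) (w : Fin (K + 1) → ℝ)
    (M : Fin (K + 1) → S → S → ℝ) (x y : Fin (K + 1) → S) :
    prodKernel w M x y
      = prodKernel w (fun i u v => M i ((L i).symm u) ((L i).symm v)) (fun i => L i (x i)) (fun i => L i (y i)) := by
  rw [prodKernel_apply, prodKernel_apply]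
  refine sum_congr rfl fun j _ => ?_
  have hiff : (fun i => L i (y i)) = update (fun i => L i (x i)) j (L j (y j)) ↔ y = update x j (y j) := by
    constructor
    · intro h; funext i
      have hi := congrFun h i
      by_cases hij : i = j
      · subst hij; rw [update_self]
      · rw [update_of_ne hij] at hi; rw [update_of_ne hij]; exact (L i).injective hi
    · intro h; funext i
      by_cases hij : i = j
      · subst hij; rw [update_self]
      · rw [update_of_ne hij]; exact congrArg (L i) (by rw [congrFun h i, update_of_ne hij])
  unfold coordKernel
  simp only [Equiv.symm_apply_apply]
  rw [if_congr hiff rfl rfl]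

/-! ## §2 The star relabelling `Ψ(x)_0 = x_0`, `Ψ(x)_{k+1} = φ_k⁻¹(x_{k+1})` -/

section Star
variable (φ : Fin K → Equiv.Perm S)

omit [Fintype S] [DecidableEq S] in
/-- The level maps of the relabelling: identity on the hot level, `φ_k⁻¹` on level `k+1`. [ours] -/
theorem starLevel_zero : (Fin.cons (Equiv.refl S) (fun k => (φ k).symm) : Fin (K + 1) → Equiv.Perm S) 0 = Equiv.refl S :=
  Fin.cons_zero _ _

omit [Fintype S] [DecidableEq S] in
/-- The level maps on the cold levels. [ours] -/
theorem starLevel_succ (k : Fin K) :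
    (Fin.cons (Equiv.refl S) (fun k => (φ k).symm) : Fin (K + 1) → Equiv.Perm S) k.succ = (φ k).symm :=
  Fin.cons_succ _ _ k

omit [Fintype S] [DecidableEq S] in
/-- The relabelling as an equivalence of the state space acts coordinatewise. [ours] -/
theorem starRelabel_apply (x : Fin (K + 1) → S) :
    Equiv.piCongrRight (Fin.cons (Equiv.refl S) (fun k => (φ k).symm) : Fin (K + 1) → Equiv.Perm S) x
      = fun i => (Fin.cons (Equiv.refl S) (fun k => (φ k).symm) : Fin (K + 1) → Equiv.Perm S) i (x i) := rfl

omit [Fintype S] [DecidableEq S] in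
/-- **The relabelling straightens the map swap:** `Ψ(edgeFlowSwap φ_k 0 (k+1) x) = Ψ(x) ∘ τ_k`. [ours] -/
theorem starRelabel_edgeFlowSwap (x : Fin (K + 1) → S) (k : Fin K) :
    (fun i => (Fin.cons (Equiv.refl S) (fun k => (φ k).symm) : Fin (K + 1) → Equiv.Perm S) i
        (edgeFlowSwap (φ k) 0 k.succ x i))
      = (fun i => (Fin.cons (Equiv.refl S) (fun k => (φ k).symm) : Fin (K + 1) → Equiv.Perm S) i (x i))
          ∘ Equiv.swap (0 : Fin (K + 1)) k.succ := by
  have hne : (0 : Fin (K + 1)) ≠ k.succ := (Fin.succ_ne_zero k).symm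
  funext i
  simp only [Function.comp_apply]
  by_cases h0 : i = 0
  · subst h0
    rw [Equiv.swap_apply_left, edgeFlowSwap_fst _ hne, starLevel_zero, starLevel_succ]; rfl
  · by_cases h1 : i = k.succ
    · subst h1
      rw [Equiv.swap_apply_right, edgeFlowSwap_snd, starLevel_succ, starLevel_zero, Equiv.symm_apply_apply]; rfl
    · rw [Equiv.swap_apply_of_ne_of_ne h0 h1, edgeFlowSwap_of_ne _ _ _ _ h0 h1]

omit [Fintype S] [DecidableEq S] in
/-- The product law relabels onto the pulled-back laws: `π̃_μ(x) = ν̃(Ψx)` with `ν_i = μ_i ∘ L_i⁻¹`. [ours] -/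
theorem tensorFun_starRelabel (μ : Fin (K + 1) → S → ℝ) (x : Fin (K + 1) → S) :
    tensorFun μ x = tensorFun (fun i u => μ i (((Fin.cons (Equiv.refl S) (fun k => (φ k).symm) :
        Fin (K + 1) → Equiv.Perm S) i).symm u))
      (fun i => (Fin.cons (Equiv.refl S) (fun k => (φ k).symm) : Fin (K + 1) → Equiv.Perm S) i (x i)) := by
  unfold tensorFun
  simp only [Equiv.symm_apply_apply]

omit [Fintype S] in
/-- The star proposal with maps relabels onto the star proposal with identity maps. [ours] -/
theorem ptGraphProposal_starRelabel (x y : Fin (K + 1) → S) :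
    ptGraphProposal (fun k : Fin K => ((0 : Fin (K + 1)), k.succ)) φ x y
      = ptGraphProposal (fun k : Fin K => ((0 : Fin (K + 1)), k.succ)) (fun _ : Fin K => Equiv.refl S)
          (fun i => (Fin.cons (Equiv.refl S) (fun k => (φ k).symm) : Fin (K + 1) → Equiv.Perm S) i (x i))
          (fun i => (Fin.cons (Equiv.refl S) (fun k => (φ k).symm) : Fin (K + 1) → Equiv.Perm S) i (y i)) := by
  unfold ptGraphProposal
  refine sum_congr rfl fun k _ => ?_
  have hΨinj : Function.Injective (fun (z : Fin (K + 1) → S) (i : Fin (K + 1)) =>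
      (Fin.cons (Equiv.refl S) (fun k => (φ k).symm) : Fin (K + 1) → Equiv.Perm S) i (z i)) := by
    intro z z' h; funext i; exact ((Fin.cons (Equiv.refl S) (fun k => (φ k).symm) : Fin (K + 1) → Equiv.Perm S) i).injective
      (congrFun h i)
  refine if_congr ?_ rfl rfl
  simp only
  rw [edgeFlowSwap_one (Fin.succ_ne_zero k).symm, ← starRelabel_edgeFlowSwap φ x k]
  exact ⟨fun h => by rw [h], fun h => hΨinj h⟩

/-- **THE CONJUGATION:** `P^φ(x,y) = P^1_ν(Ψx, Ψy)` — the map-assisted star for `(μ, M, w)` is the identity-map star for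
the pulled-back laws `ν_i = μ_i∘L_i⁻¹` and the conjugated updates `M^L`, read through `Ψ`. [ours] -/
theorem flowStar_apply_eq_conj (hμ : ∀ k x, 0 < μ k x) (t : ℝ) (w : Fin (K + 1) → ℝ) (x y : Fin (K + 1) → S) :
    t * ptGraphSwap μ (fun k : Fin K => ((0 : Fin (K + 1)), k.succ)) φ x y + (1 - t) * prodKernel w M x y
      = t * ptGraphSwap (fun i u => μ i (((Fin.cons (Equiv.refl S) (fun k => (φ k).symm) :
              Fin (K + 1) → Equiv.Perm S) i).symm u))
            (fun k : Fin K => ((0 : Fin (K + 1)), k.succ)) (fun _ : Fin K => Equiv.refl S)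
            (fun i => (Fin.cons (Equiv.refl S) (fun k => (φ k).symm) : Fin (K + 1) → Equiv.Perm S) i (x i))
            (fun i => (Fin.cons (Equiv.refl S) (fun k => (φ k).symm) : Fin (K + 1) → Equiv.Perm S) i (y i))
        + (1 - t) * prodKernel w (fun i u v => M i
              (((Fin.cons (Equiv.refl S) (fun k => (φ k).symm) : Fin (K + 1) → Equiv.Perm S) i).symm u)
              (((Fin.cons (Equiv.refl S) (fun k => (φ k).symm) : Fin (K + 1) → Equiv.Perm S) i).symm v))
            (fun i => (Fin.cons (Equiv.refl S) (fun k => (φ k).symm) : Fin (K + 1) → Equiv.Perm S) i (x i))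
            (fun i => (Fin.cons (Equiv.refl S) (fun k => (φ k).symm) : Fin (K + 1) → Equiv.Perm S) i (y i)) := by
  have _ := hμ
  congr 2
  · unfold ptGraphSwap
    have h := mhKernel_conj (Equiv.piCongrRight (Fin.cons (Equiv.refl S) (fun k => (φ k).symm) :
        Fin (K + 1) → Equiv.Perm S))
      (T := ptGraphProposal (fun k : Fin K => ((0 : Fin (K + 1)), k.succ)) φ) (π := tensorFun μ)
      (fun a b => by rw [starRelabel_apply, starRelabel_apply]; exact ptGraphProposal_starRelabel φ a b)
      (fun a => by rw [starRelabel_apply]; exact tensorFun_starRelabel φ μ a) x y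
    rw [starRelabel_apply, starRelabel_apply] at h
    exact h
  · exact prodKernel_conj _ w M x y

/-- **THE SPECTRAL GAP OF THE MAP-ASSISTED STAR IS THAT OF THE CONJUGATE PLAIN STAR:** `Gap_π̃(P^φ) = Gap_ν̃(P^1_ν)`. [ours] -/
theorem flowStar_spectralGap_eq (hμ : ∀ k x, 0 < μ k x) (t : ℝ) (w : Fin (K + 1) → ℝ) :
    spectralGap (tensorFun μ) (fun x y : Fin (K + 1) → S =>
        t * ptGraphSwap μ (fun k : Fin K => ((0 : Fin (K + 1)), k.succ)) φ x y + (1 - t) * prodKernel w M x y)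
      = spectralGap (tensorFun (fun i u => μ i (((Fin.cons (Equiv.refl S) (fun k => (φ k).symm) :
            Fin (K + 1) → Equiv.Perm S) i).symm u)))
          (fun x y : Fin (K + 1) → S =>
            t * ptGraphSwap (fun i u => μ i (((Fin.cons (Equiv.refl S) (fun k => (φ k).symm) :
                  Fin (K + 1) → Equiv.Perm S) i).symm u))
                (fun k : Fin K => ((0 : Fin (K + 1)), k.succ)) (fun _ : Fin K => Equiv.refl S) x y
              + (1 - t) * prodKernel w (fun i u v => M i
                  (((Fin.cons (Equiv.refl S) (fun k => (φ k).symm) : Fin (K + 1) → Equiv.Perm S) i).symm u)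
                  (((Fin.cons (Equiv.refl S) (fun k => (φ k).symm) : Fin (K + 1) → Equiv.Perm S) i).symm v)) x y) := by
  refine Eq.trans ?_ (spectralGap_conj (Equiv.piCongrRight (Fin.cons (Equiv.refl S) (fun k => (φ k).symm) :
    Fin (K + 1) → Equiv.Perm S)) _ _)
  congr 1
  · funext x; rw [starRelabel_apply]; exact tensorFun_starRelabel φ μ x
  · funext x y; rw [starRelabel_apply, starRelabel_apply]; exact flowStar_apply_eq_conj φ hμ t w x y

/-! ## §3 The floors with the transport ratio -/

/-- **THE MAP-ASSISTED STAR FLOOR:** with the two-sided TRANSPORT ratio `ρ·μ_0(u) ≤ μ_{k+1}(φ_k u) ≤ μ_0(u)/ρ`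
(`0 < ρ ≤ 1`), update weights `w` with `w_0 > 0`, hot Poincaré constant `γ₀`, cold updates arbitrary
`μ_k`-reversible (`K ≥ 1`, `0 < t < 1`, `|S| ≥ 2`): `Gap(P^φ) ≥ 1/(3K(ρ²+1)/(tρ⁴) + (ρ³+3K)/(ρ³γ₀(1−t)w_0))`. [ours] -/
theorem flowStar_spectralGap_ge [Nontrivial S] (hK : 1 ≤ K) (hμ : ∀ k x, 0 < μ k x) (hμ1 : ∀ k, ∑ u, μ k u = 1)
    (hM : ∀ k, IsRowStochastic (M k)) (hMrev : ∀ k, DetailedBalance (μ k) (M k)) (hw0 : ∀ k, 0 ≤ w k)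
    (hw1 : ∑ k, w k = 1) (hwhot : 0 < w 0) (ht0 : 0 < t) (ht1 : t < 1) {ρ γ₀ : ℝ} (hρ : 0 < ρ) (hρ1 : ρ ≤ 1)
    (hγ₀ : 0 < γ₀) (hρc : ∀ (k : Fin K) (u : S), ρ * μ 0 u ≤ μ k.succ (φ k u))
    (hρh : ∀ (k : Fin K) (u : S), ρ * μ k.succ (φ k u) ≤ μ 0 u)
    (hgap0 : ∀ h : S → ℝ, γ₀ * lawVariance (μ 0) h ≤ dirichletForm (μ 0) (M 0) h) :
    1 / (3 * K * (ρ ^ 2 + 1) / (t * ρ ^ 4) + (ρ ^ 3 + 3 * K) / (ρ ^ 3 * γ₀ * (1 - t) * w 0))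
      ≤ spectralGap (tensorFun μ) (fun x y : Fin (K + 1) → S =>
          t * ptGraphSwap μ (fun k : Fin K => ((0 : Fin (K + 1)), k.succ)) φ x y + (1 - t) * prodKernel w M x y) := by
  rw [flowStar_spectralGap_eq φ hμ t w]
  set L : Fin (K + 1) → Equiv.Perm S := Fin.cons (Equiv.refl S) (fun k => (φ k).symm) with hL
  have hL0 : ∀ u, (L 0).symm u = u := fun u => by rw [hL, starLevel_zero]; rfl
  have hLs : ∀ (k : Fin K) (u : S), (L k.succ).symm u = φ k u := fun k u => by
    rw [hL, starLevel_succ, Equiv.symm_symm]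
  have hν0 : (fun u => μ 0 ((L 0).symm u)) = μ 0 := funext fun u => by rw [hL0]
  have hM0 : (fun u v => M 0 ((L 0).symm u) ((L 0).symm v)) = M 0 := funext fun u => funext fun v => by rw [hL0, hL0]
  refine weightedStar_spectralGap_ge (μ := fun i u => μ i ((L i).symm u))
    (M := fun i u v => M i ((L i).symm u) ((L i).symm v)) hK (fun k u => hμ k _)
    (fun k => by rw [Equiv.sum_comp (L k).symm (μ k)]; exact hμ1 k) (fun k => ⟨fun u v => (hM k).1 _ _, fun u => ?_⟩)
    (fun k u v => hMrev k _ _) hw0 hw1 hwhot ht0 ht1 hρ hρ1 hγ₀ (fun k u => ?_) (fun k u => ?_) ?_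
  · simpa using (Equiv.sum_comp (L k).symm (fun v => M k ((L k).symm u) v)).trans ((hM k).2 _)
  · simp only [hL0, hLs]; exact hρc k u
  · simp only [hL0, hLs]; exact hρh k u
  · intro h
    have e1 : lawVariance (fun u => μ 0 ((L 0).symm u)) h = lawVariance (μ 0) h := by rw [hν0]
    have e2 : dirichletForm (fun u => μ 0 ((L 0).symm u)) (fun u v => M 0 ((L 0).symm u) ((L 0).symm v)) h
        = dirichletForm (μ 0) (M 0) h := by rw [hν0, hM0]
    rw [e1, e2]; exact hgap0 h

/-- **PERFECT TRANSPORTS, HOT-ONLY UPDATES: `Gap(P^φ) ≥ min{t, γ₀(1−t)}/(10K)` FOR ARBITRARY COLD LAWS** — if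
`μ_{k+1}(φ_k u) = μ_0(u)` for every `k`, `u` (each `φ_k` transports the hot law onto the cold law `k+1`) and every update
is spent on the hot replica (`w = 𝟙_{k=0}`; the cold replicas are never updated). [ours] -/
theorem flowStarPerfect_spectralGap_ge_linear [Nontrivial S] (hK : 1 ≤ K) (hμ : ∀ k x, 0 < μ k x)
    (hμ1 : ∀ k, ∑ u, μ k u = 1) (hM : ∀ k, IsRowStochastic (M k)) (hMrev : ∀ k, DetailedBalance (μ k) (M k))
    (ht0 : 0 < t) (ht1 : t < 1) (hperfect : ∀ (k : Fin K) (u : S), μ k.succ (φ k u) = μ 0 u) {γ₀ : ℝ} (hγ₀ : 0 < γ₀)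
    (hgap0 : ∀ h : S → ℝ, γ₀ * lawVariance (μ 0) h ≤ dirichletForm (μ 0) (M 0) h) :
    min t (γ₀ * (1 - t)) / (10 * K)
      ≤ spectralGap (tensorFun μ) (fun x y : Fin (K + 1) → S =>
          t * ptGraphSwap μ (fun k : Fin K => ((0 : Fin (K + 1)), k.succ)) φ x y
            + (1 - t) * prodKernel (fun k : Fin (K + 1) => if k = 0 then (1 : ℝ) else 0) M x y) := by
  rw [flowStar_spectralGap_eq φ hμ t]
  set L : Fin (K + 1) → Equiv.Perm S := Fin.cons (Equiv.refl S) (fun k => (φ k).symm) with hL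
  have hL0 : ∀ u, (L 0).symm u = u := fun u => by rw [hL, starLevel_zero]; rfl
  have hLs : ∀ (k : Fin K) (u : S), (L k.succ).symm u = φ k u := fun k u => by
    rw [hL, starLevel_succ, Equiv.symm_symm]
  have hν0 : (fun u => μ 0 ((L 0).symm u)) = μ 0 := funext fun u => by rw [hL0]
  have hM0 : (fun u v => M 0 ((L 0).symm u) ((L 0).symm v)) = M 0 := funext fun u => funext fun v => by rw [hL0, hL0]
  refine hotOnlyStar_spectralGap_ge_linear (μ := fun i u => μ i ((L i).symm u))
    (M := fun i u v => M i ((L i).symm u) ((L i).symm v)) hK (fun k u => hμ k _)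
    (fun k => by rw [Equiv.sum_comp (L k).symm (μ k)]; exact hμ1 k) (fun k => ⟨fun u v => (hM k).1 _ _, fun u => ?_⟩)
    (fun k u v => hMrev k _ _) ht0 ht1 (fun k => ?_) hγ₀ ?_
  · simpa using (Equiv.sum_comp (L k).symm (fun v => M k ((L k).symm u) v)).trans ((hM k).2 _)
  · funext u
    rcases Fin.eq_zero_or_eq_succ k with h | ⟨j, hj⟩
    · subst h; rfl
    · subst hj; simp only [hL0, hLs]; exact hperfect j u
  · intro h
    have e1 : lawVariance (fun u => μ 0 ((L 0).symm u)) h = lawVariance (μ 0) h := by rw [hν0]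
    have e2 : dirichletForm (fun u => μ 0 ((L 0).symm u)) (fun u v => M 0 ((L 0).symm u) ((L 0).symm v)) h
        = dirichletForm (μ 0) (M 0) h := by rw [hν0, hM0]
    rw [e1, e2]; exact hgap0 h

/-- **Sector-preserving maps keep every sector count along the star swap:** if `φ_k u ∈ A ↔ u ∈ A` for all `k`, then
`GSw^φ(x,y) ≠ 0 ⇒ #{i : y_i ∈ A} = #{i : x_i ∈ A}`. [ours] -/
theorem flowStar_sectorCount_eq (hμ : ∀ k x, 0 < μ k x) {A : Finset S} (hφA : ∀ (k : Fin K) (u : S), φ k u ∈ A ↔ u ∈ A)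
    (x y : Fin (K + 1) → S) (hxy : ptGraphSwap μ (fun k : Fin K => ((0 : Fin (K + 1)), k.succ)) φ x y ≠ 0) :
    ∑ i, (if y i ∈ A then (1 : ℝ) else 0) = ∑ i, (if x i ∈ A then (1 : ℝ) else 0) := by
  rcases ptGraphSwap_ne_zero (fun k => (Fin.succ_ne_zero k).symm) hμ hxy with h | ⟨k, hk⟩
  · rw [h]
  · have hne : (0 : Fin (K + 1)) ≠ k.succ := (Fin.succ_ne_zero k).symm
    have hφA' : ∀ u, (φ k).symm u ∈ A ↔ u ∈ A := fun u => by
      have := hφA k ((φ k).symm u); rw [Equiv.apply_symm_apply] at this; exact this.symm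
    rw [hk]
    simp only
    -- compare coordinatewise with `x ∘ τ_k`
    have e : ∀ i, (if edgeFlowSwap (φ k) 0 k.succ x i ∈ A then (1 : ℝ) else 0)
        = (if x (Equiv.swap (0 : Fin (K + 1)) k.succ i) ∈ A then (1 : ℝ) else 0) := by
      intro i
      by_cases h0 : i = 0
      · subst h0; rw [edgeFlowSwap_fst _ hne, Equiv.swap_apply_left]; exact if_congr (hφA' _) rfl rfl
      · by_cases h1 : i = k.succ
        · subst h1; rw [edgeFlowSwap_snd, Equiv.swap_apply_right]; exact if_congr (hφA k _) rfl rfl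
        · rw [edgeFlowSwap_of_ne _ _ _ _ h0 h1, Equiv.swap_apply_of_ne_of_ne h0 h1]
    simp_rw [e]
    exact Equiv.sum_comp (Equiv.swap (0 : Fin (K + 1)) k.succ) (fun i => if x i ∈ A then (1 : ℝ) else 0)

/-- **THE TWO-SIDED LINEAR LAW FOR THE MAP-ASSISTED STAR:** perfect, sector-preserving transports (`μ_{k+1}∘φ_k = μ_0`,
`φ_k(A) = A`), hot-only updates, hot Poincaré constant `γ₀`, and `μ_k(A)μ_k(Aᶜ) ≥ v > 0` at the cold levels:
`min{t, γ₀(1−t)}/(10K) ≤ Gap(P^φ) ≤ t·min{μ_0(A), μ_0(Aᶜ)}/(K·v)`. [ours] -/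
theorem flowStarPerfect_spectralGap_two_sided [Nontrivial S] (hK : 1 ≤ K) (hμ : ∀ k x, 0 < μ k x)
    (hμ1 : ∀ k, ∑ u, μ k u = 1) (hM : ∀ k, IsRowStochastic (M k)) (hMrev : ∀ k, DetailedBalance (μ k) (M k))
    (ht0 : 0 < t) (ht1 : t < 1) (hperfect : ∀ (k : Fin K) (u : S), μ k.succ (φ k u) = μ 0 u) {γ₀ : ℝ} (hγ₀ : 0 < γ₀)
    (hgap0 : ∀ h : S → ℝ, γ₀ * lawVariance (μ 0) h ≤ dirichletForm (μ 0) (M 0) h) {A : Finset S}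
    (hφA : ∀ (k : Fin K) (u : S), φ k u ∈ A ↔ u ∈ A) {v : ℝ} (hvpos : 0 < v)
    (hv : ∀ k : Fin (K + 1), k ≠ 0 → v ≤ (∑ u ∈ A, μ k u) * ∑ u ∈ Aᶜ, μ k u) :
    min t (γ₀ * (1 - t)) / (10 * K)
        ≤ spectralGap (tensorFun μ) (fun x y : Fin (K + 1) → S =>
            t * ptGraphSwap μ (fun k : Fin K => ((0 : Fin (K + 1)), k.succ)) φ x y
              + (1 - t) * prodKernel (fun k : Fin (K + 1) => if k = 0 then (1 : ℝ) else 0) M x y)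
      ∧ spectralGap (tensorFun μ) (fun x y : Fin (K + 1) → S =>
            t * ptGraphSwap μ (fun k : Fin K => ((0 : Fin (K + 1)), k.succ)) φ x y
              + (1 - t) * prodKernel (fun k : Fin (K + 1) => if k = 0 then (1 : ℝ) else 0) M x y)
          ≤ t * min (∑ u ∈ A, μ 0 u) (∑ u ∈ Aᶜ, μ 0 u) / (K * v) := by
  refine ⟨flowStarPerfect_spectralGap_ge_linear φ hK hμ hμ1 hM hMrev ht0 ht1 hperfect hγ₀ hgap0, ?_⟩
  have hQ := ptGraphSwap_isRowStochastic (e := fun k : Fin K => ((0 : Fin (K + 1)), k.succ)) (φ := φ) hμ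
  have hQrev := ptGraphSwap_detailedBalance (e := fun k : Fin K => ((0 : Fin (K + 1)), k.succ)) (φ := φ) hμ
  have hQA := flowStar_sectorCount_eq φ hμ hφA
  have hKpos : (0 : ℝ) < K := Nat.cast_pos.mpr (by omega)
  have hVge := coldSectorMass_ge (μ := μ) (A := A) hv
  have hw0 : ∀ k : Fin (K + 1), 0 ≤ (if k = 0 then (1 : ℝ) else 0) := fun k => by positivity
  have h := handover_spectralGap_le (w := fun k : Fin (K + 1) => if k = 0 then (1 : ℝ) else 0) hμ hμ1 hM hMrev hw0
    hotOnlyWeight_sum ht0.le ht1.le hQ hQrev hQA (lt_of_lt_of_le (mul_pos hKpos hvpos) hVge)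
  have hU0 : ∑ k : Fin (K + 1), (if k = 0 then (1 : ℝ) else 0)
      * (if k = 0 then (0 : ℝ) else edgeMeasure (μ k) (M k) A Aᶜ) = 0 :=
    Finset.sum_eq_zero fun k _ => by by_cases hk : k = 0 <;> simp [hk]
  rw [hU0, mul_zero, add_zero] at h
  have hη0 : 0 ≤ t * edgeMeasure (tensorFun μ) (ptGraphSwap μ (fun k : Fin K => ((0 : Fin (K + 1)), k.succ)) φ)
      (univ.filter (fun x : Fin (K + 1) → S => x 0 ∈ A)) (univ.filter (fun x : Fin (K + 1) → S => x 0 ∈ A))ᶜ :=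
    mul_nonneg ht0.le (edgeMeasure_nonneg (fun x => (tensorFun_pos hμ x).le) hQ.1 _ _)
  refine (h.trans (div_le_div_of_nonneg_left hη0 (by positivity) hVge)).trans ?_
  refine div_le_div_of_nonneg_right (mul_le_mul_of_nonneg_left (le_min ?_ ?_) ht0.le) (by positivity)
  · exact handoverFlow_le_hot hμ hμ1 hQ A
  · exact handoverFlow_le_hot_compl hμ hμ1 hQ hQrev A

end Star

end Summit.Ventures.LatticeQCDFlow.Scaling

end
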